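import Summits.BirchSwinnertonDyer.BirchSwinnertonDyer.Theorems.SignedLowerHalvesKobayashiLowerHalfLargeImageCongruenceShapeCert
import HarnessLib

/-!
# Route `SignedLowerHalves`, crux `KobayashiLowerHalfLargeImage` (item stmt-BirchSwinnertonDyer-19001):
# the congruence road with the partner's `λ` as a LOWER BOUND — rank donors, level lowering, and
# propagation of Kobayashi's main conjecture along a `p`-congruence (cell `bsd-ssimc`, seat
# `bsd-ssimc-k3-c3` gen 8, object «CONG-λ-BOUND»; `--supports stmt-BirchSwinnertonDyer-19001 --as helper`;
# closes nothing)

PARTITION (cell bsd-ssimc): X7 (A7) × item 3's ENGINE-FREE CORE at `p = 3` — the (pair, sign) cells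
that neither the tight-partner road (p463555/p465598, records 01–07) nor the unit-zone road reaches
(`11200bm1` odd, `379456el1` even, `222784n1` ±, `305200bw1` ±) — types-the-object-of (a congruence road
with strictly WEAKER partner hypotheses); closes PER PAIR only (records are separate files); the crux
`KobayashiLowerHalfLargeImage` (a CLASS statement) stays OPEN; nothing booked; BSD is not proved by any
of this. THEOREMS ONLY: no definition, no named fact, nothing about any curve asserted.

## The observation

In the road of `…CongruenceShape.lean` (p463555) / `…CongruenceShapeCert.lean` (p465598) the squeeze
`span_eq_span_iff_mu_le_and_lam_le` consumes only `λ(L^ε_p(E)) ≤ λ(ξ^ε(E))`: Kato's `ξ ∣ L`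
(Kobayashi Thm. 4.1, integral under surjectivity) already gives `≥`. Hence B. D. Kim's ALGEBRAIC transfer
`λ(X^ε(E)) + Σ_{S₀} δ_E = λ(X^ε(E′)) + Σ_{S₀} δ_{E′}` (Cor. 2.13 ∘ Cor. 2.5 ∘ Prop. 2.6, p461917) is
needed only through the INEQUALITY `λ(X^ε(E)) ≥ λ(L^ε_p(E))`, i.e. the partner enters only through a
LOWER BOUND `l′ ≤ λ(X^ε(E′))` together with the books `λ(L^ε_p(E)) + Σ δ_E ≤ l′ + Σ δ_{E′}` (§1).
Lower bounds for `λ(X^ε(E′))` are cheap and PUBLISHED (§2):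
* (D0) `l′ = 0` — no partner datum at all: a pure LEVEL-LOWERING criterion
  `Σ_{S₀} (δ_{E′} − δ_E) ≥ λ(L^ε_p(E))` (§3);
* (D1) `l′ ≤ rank E′(ℚ)` — the tree theorem `T^{rank E′(ℚ)} ∣ ξ^ε(E′)`
  (`Kobayashi2003.SignedSelmerDualData.X_pow_mordellWeilRank_dvd_of_charIdeal_eq_span`, Greenberg LNM 1716
  §1/§3) and `λ(T) = 1`: the partner needs NO `p`-adic `L`-function, NO Mazur–Tate row, NO surjectivity,
  NO newform / Pollack / modularity binder — only good reduction at `p` with `a_p(E′) = 0` (Kobayashi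
  Thm. 1.2 for torsion-ness) and enough rational points («RANK DONOR»); (D1′) `l′ = 1` from
  `r_an(E′) = 1` and Gross–Zagier–Kolyvagin — so the tight certificates `hcert′` of records 02–07 were
  redundant (rank one + the books suffice; recorded, not re-proposed);
* (D2) `λ(X^ε(E′)) = l′` (and `μ = 0`) from `KobayashiMainConjecture W′ p ε` obtained from ANY source
  (a landed per-pair theorem, Pollack–Rubin for a CM partner as in k3-c4’s «L4-λ» `SmallImageCongruenceRoad`, or an
  explicitly labelled OPEN binder such as `FouquetWan2021_thm51_via_kobayashi74_OPEN` applied to a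
  partner ON the Fouquet–Wan locus) together with the partner's OWN two-engine certificate
  `(μ, λ)(L^ε_p(E′)) = (0, l′)` — the main conjecture PROPAGATES along the congruence with NO analytic
  transfer theorem (Kim–Lee–Ponsinet arXiv:1909.01764 / Corpuz–Lei arXiv:2508.09733 NOT used) (§4).
SIGN DICTIONARY (ONE convention, the tree's, as in p463555): `ε : ℤˣ` is Kobayashi's sign of `Sel^ε`;
an ODD Mazur–Tate layer certifies `ε = −1` (tree `L⁺`), an EVEN layer `ε = 1` (tree `L⁻`).
WHY THE TOP TIER STOPS WHERE IT DOES (census, not used in any proof): at a prime `ℓ` good for `E` the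
Euler factor of any congruent `E′` divides that of `E` mod `p` (`1 − a(1+ℓ)X + ℓX² ≡ (1 − aX)(1 − aℓX)`),
so `δ_{E′}^{(ℓ)} ≤ δ_E^{(ℓ)}`; gains `δ_{E′} > δ_E` live only at the additive primes of `E` of Kodaira
type IV/IV* (inertia through `ℤ/3`, a transvection mod `3`) where `E′` is multiplicative.

References: [Kobayashi2003] Conj. (p. 2), Thm. 1.2, Thm. 4.1 (p. 8), (3.6); [BDKim2009] Cor. 2.13, 2.5,
Prop. 2.6 (pp. 185–187); [GreenbergLNM1716] §1 pp. 63, 65, §3 Lemma 3.1; [GreenbergVatsal2000] Prop. (2.4),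
p. 4, §3 Remark 3.4; [Pollack2003] Def. 6.15, Prop. 6.9/6.10/6.18; [Wuthrich2014] Lemma 20; [Washington1997] §13.2.
-/

set_option autoImplicit false
set_option linter.dupNamespace false
noncomputable section

open scoped Classical MatrixGroups ModularForm BigOperators

open CongruenceSubgroup WeierstrassCurve NumberField IsDedekindDomain
  Literature.NumberTheory.EllipticCurves
  Literature.NumberTheory.EllipticCurves.ModularForms
  Literature.NumberTheory.EllipticCurves.Rank1Residual
  Literature.NumberTheory.EllipticCurves.Rank1Residual.Typed
  Literature.NumberTheory.EllipticCurves.Kobayashi2003 ZpExtension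
  Literature.NumberTheory.EllipticCurves.GreenbergVatsal2000
  Literature.NumberTheory.EllipticCurves.BurungaleKobayashiOta2024
  Summit.BirchSwinnertonDyer.Rank1Residual.X1.MuLambda
  Summit.BirchSwinnertonDyer.Rank1Residual.Supersingular

namespace Summit.BirchSwinnertonDyer.BirchSwinnertonDyer.Theorems.CongruenceRoad

variable {W : WeierstrassCurve ℚ} [W.IsElliptic] [W.IsGloballyMinimal] {p : ℕ} [Fact p.Prime]

/-! ### §1 The road with the partner's `λ` as a LOWER bound and the books as an INEQUALITY -/

/-- **The congruence road, lower-bound form, certificate AT THE CONDUCTOR.** Inputs BY NAME: Kobayashi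
Thm. 1.2 (`h12`), Thm. 4.1 (`h41`, integral under surjectivity via Wuthrich Lemma 20 `hL20`), the
period-unit facts `h5`/`h3`, B. D. Kim 2009 Cor. 2.13 ∘ Cor. 2.5 ∘ Prop. 2.6 (`hKim`); per-pair DATA:
`p` odd good, `a_p = 0`, `ρ̄_{E,p}` onto, the newform `f₀` of `E = W` and its two-engine certificate
`hcert₀ : (μ, λ)(L^ε_p(E)) = (0, l)`, a partner `W′` good at `p` with `a_p = 0` and `W[p] ≃ W′[p]` (`he`)
with a LOWER BOUND `hlam′ : l′ ≤ λ(X^ε(W′/ℚ_∞))` (every Pontryagin-dual datum), a finite `S₀ ∌ p`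
containing the bad places of both, and the INEQUALITY `hδ : l + Σ_{S₀} δ_W ≤ l′ + Σ_{S₀} δ_{W′}`.
Then Kim gives `λ(ξ) = λ(X^ε(E)) ≥ l = λ(L)`, Kato `ξ ∣ L` gives `μ(L) = 0 ≤ μ(ξ)`, and the squeeze
`span_eq_span_iff_mu_le_and_lam_le` gives `(ξ) = (L)`; `ϖ ∈ ℤ_p^×` as in p465598. Conclusion
`KobayashiMainConjecture W p ε` VERBATIM. PER PAIR; closes nothing.
[cite: Kobayashi2003, Thm. 1.2, Thm. 4.1 (p. 8) and Conjecture (p. 2)] [cite: BDKim2009, Cor. 2.13, Cor. 2.5 and Prop. 2.6 (pp. 185–187)]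
[cite: GreenbergVatsal2000, p. 4 and §2 Prop. (2.4)] [cite: Wuthrich2014, Lemma 20 (p. 399)] -/
theorem kobayashiMainConjecture_of_lambdaTransfer_of_le_at_conductor
    (h12 : Kobayashi2003.thm12_signedSelmerDual_finite_torsion)
    (h41 : Kobayashi2003.thm41_signedCharIdeal_divisibility)
    (h5 : realPeriodRat_eq_unit_mul_plusPeriod) (h3 : realPeriodRat_eq_unit_mul_plusPeriod_three)
    (hL20 : Wuthrich2014.lemma20_surjective_threeAdic_of_semistable)
    (hKim : BDKim2009.cor213_signedLambda_add_sum_delta_eq_of_torsionIso)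
    (hp : p ≠ 2) (hgood : W.HasGoodReductionAtPrime p) (hap : W.frobeniusTrace p = 0)
    (hs : Surj W p) (ε : ℤˣ) {l : ℕ}
    [NeZero (W.conductorNorm ℤ)] {f₀ : CuspForm (Gamma0 (W.conductorNorm ℤ)) 2} (hf₀ : IsNewformOf W f₀)
    (hcert₀ : ∀ L : IwasawaAlgebra p, IsSignedPAdicLFunction f₀ p ε L → mu L = 0 ∧ lam L = l)
    {W' : WeierstrassCurve ℚ} [W'.IsElliptic] [W'.IsGloballyMinimal]
    (hgood' : W'.HasGoodReductionAtPrime p) (hap' : W'.frobeniusTrace p = 0)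
    (he : ∃ e : geomTorsion W (p : ℤ) ≃+ geomTorsion W' (p : ℤ),
      ∀ (σ : Field.absoluteGaloisGroup ℚ) (P : geomTorsion W (p : ℤ)), e (σ • P) = σ • e P)
    {l' : ℕ}
    (hlam' : ∀ (κ : ZpExtension ℚ p) (γ : Field.absoluteGaloisGroup ℚ), κ.IsCyclotomic →
      κ.IsTopGenerator γ → IsCyclotomicVariable p γ → ∀ (D' : SignedSelmerDualData W' κ γ ε)
      [Module.Finite (IwasawaAlgebra p) D'.X], Module.IsTorsion (IwasawaAlgebra p) D'.X →
      l' ≤ lambdaInvariant p D'.X)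
    (S₀ : Finset (HeightOneSpectrum (𝓞 ℚ))) (hS₀ : ∀ v ∈ S₀, ((p : ℕ) : 𝓞 ℚ) ∉ v.asIdeal)
    (hS₀W : ∀ v : HeightOneSpectrum (𝓞 ℚ), ¬ W.HasGoodReductionAt v → v ∈ S₀)
    (hS₀W' : ∀ v : HeightOneSpectrum (𝓞 ℚ), ¬ W'.HasGoodReductionAt v → v ∈ S₀)
    (hδ : l + ∑ v ∈ S₀, delta W p v ≤ l' + ∑ v ∈ S₀, delta W' p v) :
    KobayashiMainConjecture W p ε := by
  intro κ γ hκ hγ hγ' _ f hf ϖ hϖ Lplus Lminus hPP D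
  -- the newform of the quantifier is `f₀`
  have hff : f = f₀ := hf.unique hf₀
  subst hff
  haveI : Module.Finite (IwasawaAlgebra p) D.X := h12.moduleFinite hp hgood hap hκ hγ D
  have hX : Module.IsTorsion (IwasawaAlgebra p) D.X := h12.isTorsion hp hgood hap hκ hγ D
  refine ⟨hX, ?_⟩
  obtain ⟨ξ, hξ⟩ := (charIdeal_isPrincipal_holds p D.X).principal
  have hξ' : D.charIdeal = Ideal.span {ξ} := hξ
  set L := kobayashiL ε Lplus Lminus with hL_def
  have hL : IsSignedPAdicLFunction f p ε L := hPP.isSignedPAdicLFunction_kobayashiL ε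
  -- Kato–Kobayashi: `ξ ∣ L`
  have hsurj : ∀ m : ℕ, W.HasSurjectiveModNGaloisRep (p ^ m : ℕ) :=
    surjective_pow_of_surj_of_good W p hL20 hp hgood hs
  have hU : ξ ∣ L := h41.dvd_of_charIdeal_eq_span hp hgood hap hf hκ hγ hγ' hL D hX hsurj hξ'
  -- the pair's certificate
  obtain ⟨hμL, hlamL⟩ := hcert₀ L hL
  have hL0 : L ≠ 0 := by
    rw [hL_def]
    unfold kobayashiL
    split_ifs
    · exact hPP.2.1
    · exact hPP.1
  obtain ⟨h, hfac⟩ := hU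
  have hξ0 : ξ ≠ 0 := by
    rintro rfl
    exact hL0 (by rw [hfac, zero_mul])
  have hh0 : h ≠ 0 := by
    rintro rfl
    exact hL0 (by rw [hfac, mul_zero])
  -- `μ(ξ) = 0`, i.e. `μ(X^ε) = 0` (Kim's "assuming either" on `E`'s side)
  have hμξ : mu ξ = 0 := by
    have hle := mu_le_mu_mul hξ0 hh0
    rw [← hfac, hμL] at hle
    omega
  have hDmu : D.mu = 0 := by
    show muInvariant p D.X = 0
    rw [← Summit.BirchSwinnertonDyer.Rank1Residual.X1.MuPart.mu_generator_eq_muInvariant D.X hX hξ0 hξ]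
    exact hμξ
  -- the partner's datum: a LOWER bound, and Kim's transfer
  obtain ⟨D'⟩ := nonempty_signedSelmerDualData W' κ ε hγ
  haveI : Module.Finite (IwasawaAlgebra p) D'.X := h12.moduleFinite hp hgood' hap' hκ hγ D'
  have hX' : Module.IsTorsion (IwasawaAlgebra p) D'.X := h12.isTorsion hp hgood' hap' hκ hγ D'
  have hlamD' : l' ≤ lambdaInvariant p D'.X := hlam' κ γ hκ hγ hγ' D' hX'
  have hT := hKim W W' p hp hgood hap hgood' hap' he κ γ hκ hγ S₀ hS₀ hS₀W hS₀W' ε D D' hX hX' hDmu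
  have hlamD : l ≤ lambdaInvariant p D.X := by omega
  have hlamξ : l ≤ lam ξ := by
    rw [Summit.BirchSwinnertonDyer.Rank1Residual.X1.ParitySqueeze.lam_generator_eq_lambdaInvariant D.X hX
      hξ0 hξ]
    exact hlamD
  -- the squeeze `(ξ) = (L)`: only `μ(L) ≤ μ(ξ)` and `λ(L) ≤ λ(ξ)` are consumed
  have hspan : Ideal.span ({ξ} : Set (IwasawaAlgebra p)) = Ideal.span {L} :=
    ((span_eq_span_iff_mu_le_and_lam_le hξ0 hL0 hfac).mpr
      ⟨by rw [hμL]; exact Nat.zero_le _, by rw [hlamL]; exact hlamξ⟩).symm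
  -- the period ratio `ϖ` is a `p`-adic unit
  have hirr : W.HasIrreducibleModPGaloisRep p :=
    hasIrreducibleModPGaloisRep_of_dvd_frobeniusTrace W p hp
      (W.not_dvd_minimalDiscriminantInt_of_hasGoodReductionAtPrime' p hgood) (by rw [hap]; exact dvd_zero _)
  have hvϖ : padicValRat p ϖ = 0 := padicValRat_periodRatio_eq_zero h5 h3 W p hp hgood hirr f hf ϖ hϖ
  have hϖ0 : ϖ ≠ 0 := by
    intro h0
    rw [h0, Rat.cast_zero, zero_mul] at hϖ
    exact (IsNewform0.plusPeriod_pos_holds hf.1 hf.coeffField_eq_bot).ne' hϖ.symm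
  obtain ⟨u, hu⟩ := exists_units_coe_eq_ratCast hϖ0 hvϖ
  obtain ⟨hspan', hι⟩ := span_C_units_mul_eq u L
  refine ⟨PowerSeries.C (u : ℤ_[p]) * L, ?_, ?_⟩
  · rw [hξ', hspan, hspan']
  · rw [hι, hu]

/-- **Lower-bound road from an ODD-layer Mazur–Tate certificate (`ε = −1`, the tree's `L⁺`).** Data:
the newform `f₀` of `E = W`, `n` odd, `Θ ∈ Λ` with `ι Θ = θ_n(f₀)` (two engines), `Θ ≠ 0`, `μ(Θ) = 0`,
`λ(Θ) = deg ω_n^+ + l`; the partner's LOWER bound `hlam′`, `S₀`, and the inequality `hδ` as in §1.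
Conclusion `KobayashiMainConjecture W p (-1)`. PER PAIR. [cite: Pollack2003, Def. 6.15, Prop. 6.9, 6.10 and 6.18]
[cite: Kobayashi2003, Thm. 4.1 (p. 8) and Conjecture (p. 2)] [cite: BDKim2009, Cor. 2.13 (p. 187)] -/
theorem kobayashiMainConjecture_neg_one_of_lambdaTransfer_of_le_of_mazurTate
    (h12 : Kobayashi2003.thm12_signedSelmerDual_finite_torsion)
    (h41 : Kobayashi2003.thm41_signedCharIdeal_divisibility)
    (h5 : realPeriodRat_eq_unit_mul_plusPeriod) (h3 : realPeriodRat_eq_unit_mul_plusPeriod_three)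
    (hL20 : Wuthrich2014.lemma20_surjective_threeAdic_of_semistable)
    (hKim : BDKim2009.cor213_signedLambda_add_sum_delta_eq_of_torsionIso)
    (hp : p ≠ 2) (hgood : W.HasGoodReductionAtPrime p) (hap : W.frobeniusTrace p = 0)
    (hs : Surj W p) {l : ℕ}
    [NeZero (W.conductorNorm ℤ)] {f₀ : CuspForm (Gamma0 (W.conductorNorm ℤ)) 2} (hf₀ : IsNewformOf W f₀)
    {n : ℕ} (hn : Odd n) {Θ : IwasawaAlgebra p}
    (hΘ : iwasawaToPowerSeries p Θ =
      ((mazurTateElement f₀ p n).map (algebraMap ℚ ℚ_[p]) : PowerSeries ℚ_[p]))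
    (hΘ0 : Θ ≠ 0) (hμ : mu Θ = 0) (hlam : lam Θ = (cyclotomicOmegaPlus p n).natDegree + l)
    {W' : WeierstrassCurve ℚ} [W'.IsElliptic] [W'.IsGloballyMinimal]
    (hgood' : W'.HasGoodReductionAtPrime p) (hap' : W'.frobeniusTrace p = 0)
    (he : ∃ e : geomTorsion W (p : ℤ) ≃+ geomTorsion W' (p : ℤ),
      ∀ (σ : Field.absoluteGaloisGroup ℚ) (P : geomTorsion W (p : ℤ)), e (σ • P) = σ • e P)
    {l' : ℕ}
    (hlam' : ∀ (κ : ZpExtension ℚ p) (γ : Field.absoluteGaloisGroup ℚ), κ.IsCyclotomic →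
      κ.IsTopGenerator γ → IsCyclotomicVariable p γ → ∀ (D' : SignedSelmerDualData W' κ γ (-1))
      [Module.Finite (IwasawaAlgebra p) D'.X], Module.IsTorsion (IwasawaAlgebra p) D'.X →
      l' ≤ lambdaInvariant p D'.X)
    (S₀ : Finset (HeightOneSpectrum (𝓞 ℚ))) (hS₀ : ∀ v ∈ S₀, ((p : ℕ) : 𝓞 ℚ) ∉ v.asIdeal)
    (hS₀W : ∀ v : HeightOneSpectrum (𝓞 ℚ), ¬ W.HasGoodReductionAt v → v ∈ S₀)
    (hS₀W' : ∀ v : HeightOneSpectrum (𝓞 ℚ), ¬ W'.HasGoodReductionAt v → v ∈ S₀)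
    (hδ : l + ∑ v ∈ S₀, delta W p v ≤ l' + ∑ v ∈ S₀, delta W' p v) :
    KobayashiMainConjecture W p (-1) :=
  kobayashiMainConjecture_of_lambdaTransfer_of_le_at_conductor h12 h41 h5 h3 hL20 hKim hp hgood hap hs (-1)
    hf₀ (fun _ hL ↦ lam_signed_neg_one_eq_of_mazurTate' hp hf₀ hgood hap hL hn hΘ hΘ0 hμ hlam)
    hgood' hap' he hlam' S₀ hS₀ hS₀W hS₀W' hδ

/-- **Lower-bound road from an EVEN-layer Mazur–Tate certificate (`ε = 1`, the tree's `L⁻`)**: `n` even,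
`λ(Θ) = deg ω_n^- + l`. PER PAIR. [cite: Pollack2003, Def. 6.15, Prop. 6.9, 6.10 and 6.18]
[cite: Kobayashi2003, Thm. 4.1 (p. 8) and Conjecture (p. 2)] [cite: BDKim2009, Cor. 2.13 (p. 187)] -/
theorem kobayashiMainConjecture_one_of_lambdaTransfer_of_le_of_mazurTate
    (h12 : Kobayashi2003.thm12_signedSelmerDual_finite_torsion)
    (h41 : Kobayashi2003.thm41_signedCharIdeal_divisibility)
    (h5 : realPeriodRat_eq_unit_mul_plusPeriod) (h3 : realPeriodRat_eq_unit_mul_plusPeriod_three)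
    (hL20 : Wuthrich2014.lemma20_surjective_threeAdic_of_semistable)
    (hKim : BDKim2009.cor213_signedLambda_add_sum_delta_eq_of_torsionIso)
    (hp : p ≠ 2) (hgood : W.HasGoodReductionAtPrime p) (hap : W.frobeniusTrace p = 0)
    (hs : Surj W p) {l : ℕ}
    [NeZero (W.conductorNorm ℤ)] {f₀ : CuspForm (Gamma0 (W.conductorNorm ℤ)) 2} (hf₀ : IsNewformOf W f₀)
    {n : ℕ} (hn : Even n) {Θ : IwasawaAlgebra p}
    (hΘ : iwasawaToPowerSeries p Θ =
      ((mazurTateElement f₀ p n).map (algebraMap ℚ ℚ_[p]) : PowerSeries ℚ_[p]))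
    (hΘ0 : Θ ≠ 0) (hμ : mu Θ = 0) (hlam : lam Θ = (cyclotomicOmegaMinus p n).natDegree + l)
    {W' : WeierstrassCurve ℚ} [W'.IsElliptic] [W'.IsGloballyMinimal]
    (hgood' : W'.HasGoodReductionAtPrime p) (hap' : W'.frobeniusTrace p = 0)
    (he : ∃ e : geomTorsion W (p : ℤ) ≃+ geomTorsion W' (p : ℤ),
      ∀ (σ : Field.absoluteGaloisGroup ℚ) (P : geomTorsion W (p : ℤ)), e (σ • P) = σ • e P)
    {l' : ℕ}
    (hlam' : ∀ (κ : ZpExtension ℚ p) (γ : Field.absoluteGaloisGroup ℚ), κ.IsCyclotomic →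
      κ.IsTopGenerator γ → IsCyclotomicVariable p γ → ∀ (D' : SignedSelmerDualData W' κ γ 1)
      [Module.Finite (IwasawaAlgebra p) D'.X], Module.IsTorsion (IwasawaAlgebra p) D'.X →
      l' ≤ lambdaInvariant p D'.X)
    (S₀ : Finset (HeightOneSpectrum (𝓞 ℚ))) (hS₀ : ∀ v ∈ S₀, ((p : ℕ) : 𝓞 ℚ) ∉ v.asIdeal)
    (hS₀W : ∀ v : HeightOneSpectrum (𝓞 ℚ), ¬ W.HasGoodReductionAt v → v ∈ S₀)
    (hS₀W' : ∀ v : HeightOneSpectrum (𝓞 ℚ), ¬ W'.HasGoodReductionAt v → v ∈ S₀)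
    (hδ : l + ∑ v ∈ S₀, delta W p v ≤ l' + ∑ v ∈ S₀, delta W' p v) :
    KobayashiMainConjecture W p 1 :=
  kobayashiMainConjecture_of_lambdaTransfer_of_le_at_conductor h12 h41 h5 h3 hL20 hKim hp hgood hap hs 1
    hf₀ (fun _ hL ↦ lam_signed_one_eq_of_mazurTate' hp hf₀ hgood hap hL hn hΘ hΘ0 hμ hlam)
    hgood' hap' he hlam' S₀ hS₀ hS₀W hS₀W' hδ

/-! ### §2 Lower bounds for the partner's `λ(X^ε)`: rational points (D1), analytic rank one (D1′) -/

/-- **(D1) Rank donor: `rank E′(ℚ) ≤ λ(X^ε(E′/ℚ_∞))`.** For `E′ = W′` with `p` odd good and `a_p = 0`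
(so that `X^ε` is finitely generated torsion, Kobayashi Thm. 1.2 `h12`), for every admissible
`(κ, γ)` and every Pontryagin-dual datum `D′` of `Sel^ε(E′/ℚ_∞)`: `W′.mordellWeilRank ≤ λ(D′.X)` —
the tree theorem `T^{rank E′(ℚ)} ∣ ξ^ε` (`X_pow_mordellWeilRank_dvd_of_charIdeal_eq_span`, from the
Kummer points inside `Sel^ε` over `ℚ`) and `λ(T^r·g) ≥ r`. NO `L`-function, NO surjectivity, NO
certificate for `E′`. Hence any `l′ ≤ rank E′(ℚ)` is an admissible `hlam′` for §1. PER PARTNER.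
[cite: GreenbergLNM1716, §1 pp. 63, 65 and §3 Lemma 3.1] [cite: Kobayashi2003, Def. 1.1 and Thm. 1.2 (p. 2)]
[cite: Washington1997, §13.2] -/
theorem le_lambdaInvariant_of_le_mordellWeilRank
    {W' : WeierstrassCurve ℚ} [W'.IsElliptic] [W'.IsGloballyMinimal] (ε : ℤˣ) {l' : ℕ}
    (hr : l' ≤ W'.mordellWeilRank) :
    ∀ (κ : ZpExtension ℚ p) (γ : Field.absoluteGaloisGroup ℚ), κ.IsCyclotomic →
      κ.IsTopGenerator γ → IsCyclotomicVariable p γ → ∀ (D' : SignedSelmerDualData W' κ γ ε)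
      [Module.Finite (IwasawaAlgebra p) D'.X], Module.IsTorsion (IwasawaAlgebra p) D'.X →
      l' ≤ lambdaInvariant p D'.X := by
  intro κ γ _ hγ _ D' _ hX'
  obtain ⟨ξ, hξ⟩ := (charIdeal_isPrincipal_holds p D'.X).principal
  have hξ' : D'.charIdeal = Ideal.span {ξ} := hξ
  have hξ0 : ξ ≠ 0 := by
    rintro rfl
    have hbot : D'.charIdeal = ⊥ := by rw [hξ', Ideal.span_singleton_eq_bot]
    exact Literature.NumberTheory.EllipticCurves.Module.charIdeal_ne_bot (IwasawaAlgebra p) D'.X hbot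
  have hC := D'.X_pow_mordellWeilRank_dvd_of_charIdeal_eq_span hγ hX' hξ'
  have hge : W'.mordellWeilRank ≤ lam ξ :=
    Summit.BirchSwinnertonDyer.Rank1Residual.X2.le_lam_of_X_pow_dvd hξ0 hC
  rw [← Summit.BirchSwinnertonDyer.Rank1Residual.X1.ParitySqueeze.lam_generator_eq_lambdaInvariant D'.X hX'
    hξ0 hξ]
  exact hr.trans hge

/-- **(D1′) Analytic rank one donor: `1 ≤ λ(X^ε(E′/ℚ_∞))`** for `r_an(E′) = 1`, via
Gross–Zagier–Kolyvagin (`hGZK`: `rank E′(ℚ) = r_an(E′)` for `r_an ≤ 1`) and (D1). NO certificate for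
`E′`: the tight hypothesis `(μ, λ)(L^ε_p(E′)) = (0, 1)` of `lambdaInvariant_eq_one_of_cert_at_conductor_of_analyticRank_eq_one`
(p465598) is not needed for the LOWER bound. PER PARTNER. [cite: GreenbergLNM1716, §3 Lemma 3.1]
[cite: Kobayashi2003, Thm. 1.2 (p. 2)] -/
theorem one_le_lambdaInvariant_of_analyticRank_eq_one
    (hGZK : rank_eq_analyticRank_of_analyticRank_le_one)
    {W' : WeierstrassCurve ℚ} [W'.IsElliptic] [W'.IsGloballyMinimal] (ε : ℤˣ)
    (h1 : W'.analyticRank = 1) :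
    ∀ (κ : ZpExtension ℚ p) (γ : Field.absoluteGaloisGroup ℚ), κ.IsCyclotomic →
      κ.IsTopGenerator γ → IsCyclotomicVariable p γ → ∀ (D' : SignedSelmerDualData W' κ γ ε)
      [Module.Finite (IwasawaAlgebra p) D'.X], Module.IsTorsion (IwasawaAlgebra p) D'.X →
      1 ≤ lambdaInvariant p D'.X :=
  le_lambdaInvariant_of_le_mordellWeilRank (p := p) ε
    (le_of_eq ((hGZK W' (by omega)).1.trans h1).symm)

/-! ### §3 (D0) No partner datum at all: the LEVEL-LOWERING criterion -/

/-- **(D0) Level lowering inside the congruence class.** If a congruent partner `W′` (good at `p`,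
`a_p(W′) = 0`, `W[p] ≃ W′[p]`) has `Σ_{S₀} δ_{W′} ≥ λ(L^ε_p(E)) + Σ_{S₀} δ_W` — e.g. `W′` is
MULTIPLICATIVE of the matching type at enough additive Kodaira-IV/IV* primes of `E` — then
`KobayashiMainConjecture W p ε`, with NO global input about `W′` whatsoever (its `λ(X^ε) ≥ 0`
trivially). PER PAIR; closes nothing. [cite: BDKim2009, Cor. 2.13, Cor. 2.5 and Prop. 2.6 (pp. 185–187)]
[cite: GreenbergVatsal2000, §2 Prop. (2.4)] [cite: Kobayashi2003, Thm. 4.1 (p. 8) and Conjecture (p. 2)] -/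
theorem kobayashiMainConjecture_of_levelLowering_at_conductor
    (h12 : Kobayashi2003.thm12_signedSelmerDual_finite_torsion)
    (h41 : Kobayashi2003.thm41_signedCharIdeal_divisibility)
    (h5 : realPeriodRat_eq_unit_mul_plusPeriod) (h3 : realPeriodRat_eq_unit_mul_plusPeriod_three)
    (hL20 : Wuthrich2014.lemma20_surjective_threeAdic_of_semistable)
    (hKim : BDKim2009.cor213_signedLambda_add_sum_delta_eq_of_torsionIso)
    (hp : p ≠ 2) (hgood : W.HasGoodReductionAtPrime p) (hap : W.frobeniusTrace p = 0)
    (hs : Surj W p) (ε : ℤˣ) {l : ℕ}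
    [NeZero (W.conductorNorm ℤ)] {f₀ : CuspForm (Gamma0 (W.conductorNorm ℤ)) 2} (hf₀ : IsNewformOf W f₀)
    (hcert₀ : ∀ L : IwasawaAlgebra p, IsSignedPAdicLFunction f₀ p ε L → mu L = 0 ∧ lam L = l)
    {W' : WeierstrassCurve ℚ} [W'.IsElliptic] [W'.IsGloballyMinimal]
    (hgood' : W'.HasGoodReductionAtPrime p) (hap' : W'.frobeniusTrace p = 0)
    (he : ∃ e : geomTorsion W (p : ℤ) ≃+ geomTorsion W' (p : ℤ),
      ∀ (σ : Field.absoluteGaloisGroup ℚ) (P : geomTorsion W (p : ℤ)), e (σ • P) = σ • e P)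
    (S₀ : Finset (HeightOneSpectrum (𝓞 ℚ))) (hS₀ : ∀ v ∈ S₀, ((p : ℕ) : 𝓞 ℚ) ∉ v.asIdeal)
    (hS₀W : ∀ v : HeightOneSpectrum (𝓞 ℚ), ¬ W.HasGoodReductionAt v → v ∈ S₀)
    (hS₀W' : ∀ v : HeightOneSpectrum (𝓞 ℚ), ¬ W'.HasGoodReductionAt v → v ∈ S₀)
    (hδ : l + ∑ v ∈ S₀, delta W p v ≤ ∑ v ∈ S₀, delta W' p v) :
    KobayashiMainConjecture W p ε :=
  kobayashiMainConjecture_of_lambdaTransfer_of_le_at_conductor h12 h41 h5 h3 hL20 hKim hp hgood hap hs ε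
    hf₀ hcert₀ hgood' hap' he (l' := 0) (fun _ _ _ _ _ _ _ _ ↦ Nat.zero_le _) S₀ hS₀ hS₀W hS₀W'
    (by simpa using hδ)

end Summit.BirchSwinnertonDyer.BirchSwinnertonDyer.Theorems.CongruenceRoad

end
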